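import Summits.NavierStokesRegularity.NavierStokesRegularity.Theorems.ExtremiserTransienceNearExtremalTransienceExtremiserLiouvilleConstantSpeedKKT
import Mathlib.Analysis.Convex.Cone.Extension
import Mathlib.MeasureTheory.Integral.RieszMarkovKakutani.Real
import Mathlib.LinearAlgebra.Isomorphisms
import HarnessLib

/-!
# Crux `ExtremiserTransience.NearExtremalTransience` (stmt-NavierStokesRegularity-21883), line `extremiser_liouville`,
# stub K1b — THE KKT MULTIPLIER MEASURE OF A CONSTANT-SPEED EXTENDED EXTREMISER

`--supports stmt-NavierStokesRegularity-21883` (helper).  Author: prover seat `ns-el-k1b` (g3).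

Setting (the K1b residue after `…Plateau`, `…ConstantSpeedDossier`): `v` smooth, divergence free, `‖v‖ ≡ M > 0`,
`‖Dv‖` bounded, `D¹v, D²v ∈ L²`, and EXTREMAL, `|S| = κ⋆ M √Z √W` (notation of `…KStarAttainedHalfSpaceVariation`:
`Jst = S`, `Zen = Z`, `Wpa = W`, `J1, A1, C1` the first-variation integrals, `kStar = κ⋆`).  The landed KKT
inequality `ext_firstVariation_le_of_sup_inner` (p641635) says that the first-variation functional
`ℓ(φ) = S·J₁(φ) − κ⋆²M²(W a₁(φ) + Z c₁(φ))` satisfies `ℓ(φ) ≤ κ⋆² Z W · s` whenever `⟪v, φ⟫ ≤ s` pointwise, for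
every smooth compactly supported divergence-free `φ`.

**THEOREM (`exists_multiplierMeasure`).**  There is a finite positive Borel measure `μ` on `ℝ³` with total mass
`μ(ℝ³) ≤ κ⋆² Z W` such that for EVERY smooth compactly supported divergence-free `φ`
`ℓ(φ) = ∫ ⟪v x, φ x⟫ dμ(x)` — the Karush–Kuhn–Tucker multiplier of the everywhere-active constraint `‖v‖ ≤ M`
is a MEASURE, and the Euler–Lagrange equation of the residue object reads `ℓ = ⟪v, ·⟫ μ` on solenoidal test fields
(equivalently `F dx − v μ = ∇p` for the smooth Euler–Lagrange field `F` of `…KStarAttainedDensity`).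

PROOF.  (1) `ℓ` is linear in `φ` (`J1_add/J1_smul`, `A1_…`, `C1_…`: the integrands are compactly supported and
continuous, `…KStarAttainedPerturbation`).  (2) On the real vector space `C_c(ℝ³, ℝ)` the functional
`N(g) = κ⋆²ZW · sup g⁺` is sublinear, and by KKT `ℓ(φ) ≤ N(⟪v, φ⟫)`; in particular `ℓ` vanishes when `⟪v,φ⟫ ≡ 0`,
so `ℓ` factors through the subspace `{⟪v, φ⟫}` of `C_c` (first isomorphism theorem `LinearMap.quotKerEquivRange`).
(3) Hahn–Banach (`exists_extension_of_le_sublinear`) extends it to `Λ : C_c(ℝ³,ℝ) → ℝ` with `Λ ≤ N`; since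
`N(−g) = 0` for `g ≥ 0`, `Λ` is POSITIVE.  (4) Riesz–Markov–Kakutani (`RealRMK.integral_rieszMeasure`) represents
`Λ` by a regular Borel measure `μ`; testing bump functions gives `μ(closed balls) ≤ κ⋆²ZW`, whence the mass bound.

WHAT THIS IS NOT: a structural fact about HYPOTHETICAL constant-speed extremisers (the K1b residue object); K1b is
NOT proved; nothing here proves NS regularity. [folklore]
-/

noncomputable section

open Set Filter Topology MeasureTheory Metric Function
open scoped ENNReal NNReal Topology InnerProductSpace RealInnerProductSpace ContDiff
open Literature.Analysis.FluidPDE Literature.Analysis CompactlySupported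

namespace Summit.NavierStokesRegularity.NavierStokesRegularity.Theorems

-- the problem directory repeats the summit name (`NavierStokesRegularity/NavierStokesRegularity`)
set_option linter.dupNamespace false

namespace ExtremiserLiouville

open DepletionLadder.KStar DepletionLadder.KStar.HalfSpace

variable {v φ ψ : E3 → E3}

/-! ## 1. Linearity of the first-variation integrals in the test field -/

/-- `curl (φ + ψ) = curl φ + curl ψ` for differentiable fields. [folklore] -/
theorem curl_add_pi (hφ : Differentiable ℝ φ) (hψ : Differentiable ℝ ψ) : curl (φ + ψ) = curl φ + curl ψ :=
  funext fun x => curl_add (hφ x) (hψ x)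

/-- `curl (c • φ) = c • curl φ` for a differentiable field. [folklore] -/
theorem curl_smul_pi (hφ : Differentiable ℝ φ) (c : ℝ) : curl (c • φ) = c • curl φ :=
  funext fun x => curl_const_smul (hφ x) c

/-- `J₁(φ + ψ) = J₁(φ) + J₁(ψ)` for smooth compactly supported `φ, ψ`. [folklore] -/
theorem J1_add (hv : ContDiff ℝ ∞ v) (hφ : ContDiff ℝ ∞ φ) (hφc : HasCompactSupport φ)
    (hψ : ContDiff ℝ ∞ ψ) (hψc : HasCompactSupport ψ) : J1 v (φ + ψ) = J1 v φ + J1 v ψ := by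
  have hφd : Differentiable ℝ φ := hφ.differentiable (by simp)
  have hψd : Differentiable ℝ ψ := hψ.differentiable (by simp)
  have hcφ : Differentiable ℝ (curl φ) := (contDiff_curl_top hφ).differentiable (by simp)
  have hcψ : Differentiable ℝ (curl ψ) := (contDiff_curl_top hψ).differentiable (by simp)
  obtain ⟨hiφ, -, -⟩ := integrable_stretching_coeffs hv hφ hφc
  obtain ⟨hiψ, -, -⟩ := integrable_stretching_coeffs hv hψ hψc
  unfold J1
  rw [← integral_add hiφ hiψ]
  refine integral_congr_ae (Eventually.of_forall fun x => ?_)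
  have h1 : curl (φ + ψ) x = curl φ x + curl ψ x := by rw [curl_add_pi hφd hψd]; rfl
  have h2 : fderiv ℝ (φ + ψ) x = fderiv ℝ φ x + fderiv ℝ ψ x := fderiv_add (hφd x) (hψd x)
  simp only [h1, h2, inner_add_left, inner_add_right, map_add, add_apply]
  ring

/-- `J₁(c • φ) = c · J₁(φ)`. [folklore] -/
theorem J1_smul (hφ : ContDiff ℝ ∞ φ) (c : ℝ) : J1 v (c • φ) = c * J1 v φ := by
  have hφd : Differentiable ℝ φ := hφ.differentiable (by simp)
  unfold J1
  rw [← integral_const_mul]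
  refine integral_congr_ae (Eventually.of_forall fun x => ?_)
  have h1 : curl (c • φ) x = c • curl φ x := by rw [curl_smul_pi hφd]; rfl
  have h2 : fderiv ℝ (c • φ) x = c • fderiv ℝ φ x := fderiv_const_smul (hφd x) c
  simp only [h1, h2, real_inner_smul_left, real_inner_smul_right, map_smul, smul_apply]
  ring

/-- `a₁(φ + ψ) = a₁(φ) + a₁(ψ)`. [folklore] -/
theorem A1_add (hv : ContDiff ℝ ∞ v) (hφ : ContDiff ℝ ∞ φ) (hφc : HasCompactSupport φ)
    (hψ : ContDiff ℝ ∞ ψ) (hψc : HasCompactSupport ψ) : A1 v (φ + ψ) = A1 v φ + A1 v ψ := by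
  have hφd : Differentiable ℝ φ := hφ.differentiable (by simp)
  have hψd : Differentiable ℝ ψ := hψ.differentiable (by simp)
  obtain ⟨hiφ, -⟩ := integrable_enstrophy_coeffs hv hφ hφc
  obtain ⟨hiψ, -⟩ := integrable_enstrophy_coeffs hv hψ hψc
  unfold A1
  rw [← integral_add hiφ hiψ]
  refine integral_congr_ae (Eventually.of_forall fun x => ?_)
  have h1 : curl (φ + ψ) x = curl φ x + curl ψ x := by rw [curl_add_pi hφd hψd]; rfl
  simp only [h1, inner_add_right]

/-- `a₁(c • φ) = c · a₁(φ)`. [folklore] -/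
theorem A1_smul (hφ : ContDiff ℝ ∞ φ) (c : ℝ) : A1 v (c • φ) = c * A1 v φ := by
  have hφd : Differentiable ℝ φ := hφ.differentiable (by simp)
  unfold A1
  rw [← integral_const_mul]
  refine integral_congr_ae (Eventually.of_forall fun x => ?_)
  have h1 : curl (c • φ) x = c • curl φ x := by rw [curl_smul_pi hφd]; rfl
  simp only [h1, real_inner_smul_right]

/-- `c₁(φ + ψ) = c₁(φ) + c₁(ψ)`. [folklore] -/
theorem C1_add (hv : ContDiff ℝ ∞ v) (hφ : ContDiff ℝ ∞ φ) (hφc : HasCompactSupport φ)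
    (hψ : ContDiff ℝ ∞ ψ) (hψc : HasCompactSupport ψ) : C1 v (φ + ψ) = C1 v φ + C1 v ψ := by
  have hφd : Differentiable ℝ φ := hφ.differentiable (by simp)
  have hψd : Differentiable ℝ ψ := hψ.differentiable (by simp)
  have hcφ : Differentiable ℝ (curl φ) := (contDiff_curl_top hφ).differentiable (by simp)
  have hcψ : Differentiable ℝ (curl ψ) := (contDiff_curl_top hψ).differentiable (by simp)
  obtain ⟨hiφ, -⟩ := integrable_palinstrophy_coeffs hv hφ hφc
  obtain ⟨hiψ, -⟩ := integrable_palinstrophy_coeffs hv hψ hψc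
  unfold C1
  rw [← integral_add hiφ hiψ]
  refine integral_congr_ae (Eventually.of_forall fun x => ?_)
  have h1 : fderiv ℝ (curl (φ + ψ)) x = fderiv ℝ (curl φ) x + fderiv ℝ (curl ψ) x := by
    rw [curl_add_pi hφd hψd]; exact fderiv_add (hcφ x) (hcψ x)
  simp only [h1, add_apply, inner_add_right, Finset.sum_add_distrib]

/-- `c₁(c • φ) = c · c₁(φ)`. [folklore] -/
theorem C1_smul (hφ : ContDiff ℝ ∞ φ) (c : ℝ) : C1 v (c • φ) = c * C1 v φ := by
  have hφd : Differentiable ℝ φ := hφ.differentiable (by simp)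
  have hcφ : Differentiable ℝ (curl φ) := (contDiff_curl_top hφ).differentiable (by simp)
  unfold C1
  rw [← integral_const_mul]
  refine integral_congr_ae (Eventually.of_forall fun x => ?_)
  have h1 : fderiv ℝ (curl (c • φ)) x = c • fderiv ℝ (curl φ) x := by
    rw [curl_smul_pi hφd]; exact fderiv_const_smul (hcφ x) c
  simp only [h1, smul_apply, real_inner_smul_right, Finset.mul_sum]

/-- The sum of two differentiable divergence-free fields is divergence free. [folklore] -/
theorem isDivFree_add_pi (hφ : Differentiable ℝ φ) (hψ : Differentiable ℝ ψ)
    (hφdiv : VectorCalculus.IsDivFree φ) (hψdiv : VectorCalculus.IsDivFree ψ) :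
    VectorCalculus.IsDivFree (φ + ψ) := fun x => by
  have h := divergence_add_smul hφ hψ 1 x
  simp only [one_smul, one_mul, hφdiv x, hψdiv x, add_zero] at h
  exact h

/-- A scalar multiple of a differentiable divergence-free field is divergence free. [folklore] -/
theorem isDivFree_smul_pi (hφ : Differentiable ℝ φ) (hφdiv : VectorCalculus.IsDivFree φ) (c : ℝ) :
    VectorCalculus.IsDivFree (c • φ) := fun x => by
  unfold VectorCalculus.divergence
  rw [fderiv_const_smul (hφ x) c, ContinuousLinearMap.toLinearMap_smul, map_smul, smul_eq_mul]
  have := hφdiv x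
  unfold VectorCalculus.divergence at this
  rw [this, mul_zero]

/-! ## 2. The KKT inequality in the notation `Jst, J1, A1, C1, kStar` -/

/-- KKT (p641635) for the first-variation functional `ℓ(φ) = S·J₁(φ) − κ⋆²M²(W a₁(φ) + Z c₁(φ))`:
`ℓ(φ) ≤ κ⋆² Z W · s` whenever `⟪v, φ⟫ ≤ s` pointwise. [folklore] -/
theorem firstVar_le_of_inner_le (hv : ContDiff ℝ ∞ v) (hdiv : VectorCalculus.IsDivFree v) {M B : ℝ}
    (hMpos : 0 < M) (hM : ∀ x, ‖v x‖ = M) (hB : ∀ x, ‖fderiv ℝ v x‖ ≤ B)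
    (h1 : ∫⁻ x, ‖iteratedFDeriv ℝ 1 v x‖ₑ ^ 2 < ⊤) (h2 : ∫⁻ x, ‖iteratedFDeriv ℝ 2 v x‖ₑ ^ 2 < ⊤)
    (hatt : |Jst v| = kStar * M * Real.sqrt (Zen v) * Real.sqrt (Wpa v))
    (hφ : ContDiff ℝ ∞ φ) (hφc : HasCompactSupport φ) (hφdiv : VectorCalculus.IsDivFree φ)
    {s : ℝ} (hs : ∀ x, ⟪v x, φ x⟫ ≤ s) :
    Jst v * J1 v φ - kStar ^ 2 * M ^ 2 * (Wpa v * A1 v φ + Zen v * C1 v φ) ≤ kStar ^ 2 * Zen v * Wpa v * s := by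
  have h : Jst v * J1 v φ ≤ kStar ^ 2 * M ^ 2 * (s / M ^ 2 * Zen v * Wpa v + Wpa v * A1 v φ + Zen v * C1 v φ) :=
    ext_firstVariation_le_of_sup_inner hv hdiv hMpos hM hB h1 h2 hatt hφ hφc hφdiv hs
  have hM2 : M ^ 2 ≠ 0 := by positivity
  have heq : kStar ^ 2 * M ^ 2 * (s / M ^ 2 * Zen v * Wpa v) = kStar ^ 2 * Zen v * Wpa v * s := by
    field_simp
  nlinarith [h, heq]

/-! ## 3. The multiplier measure -/

/-- `x ↦ ⟪v x, φ x⟫` has compact support when `φ` has. [folklore] -/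
theorem hasCompactSupport_inner_of_right (v : E3 → E3) (hφc : HasCompactSupport φ) :
    HasCompactSupport fun x => ⟪v x, φ x⟫_ℝ :=
  hφc.mono fun x hx => by
    rw [Function.mem_support] at hx ⊢
    intro h
    exact hx (by rw [h, inner_zero_right])

/-- **The KKT multiplier measure of a constant-speed extended extremiser.**  If `v` is smooth, divergence free,
`‖v‖ ≡ M > 0`, `‖Dv‖ ≤ B`, `D¹v, D²v ∈ L²` and extremal (`|S| = κ⋆M√Z√W`), then there is a finite positive Borel
measure `μ` on `ℝ³`, `μ(ℝ³) ≤ κ⋆² Z W`, with `S·J₁(φ) − κ⋆²M²(W a₁(φ) + Z c₁(φ)) = ∫ ⟪v, φ⟫ dμ` for every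
smooth compactly supported divergence-free `φ` (Hahn–Banach + Riesz–Markov–Kakutani on the KKT inequality).
[folklore] -/
theorem exists_multiplierMeasure (hv : ContDiff ℝ ∞ v) (hdiv : VectorCalculus.IsDivFree v) {M B : ℝ}
    (hMpos : 0 < M) (hM : ∀ x, ‖v x‖ = M) (hB : ∀ x, ‖fderiv ℝ v x‖ ≤ B)
    (h1 : ∫⁻ x, ‖iteratedFDeriv ℝ 1 v x‖ₑ ^ 2 < ⊤) (h2 : ∫⁻ x, ‖iteratedFDeriv ℝ 2 v x‖ₑ ^ 2 < ⊤)
    (hatt : |Jst v| = kStar * M * Real.sqrt (Zen v) * Real.sqrt (Wpa v)) :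
    ∃ μ : Measure E3, IsFiniteMeasure μ ∧ μ univ ≤ ENNReal.ofReal (kStar ^ 2 * Zen v * Wpa v) ∧
      ∀ φ : E3 → E3, ContDiff ℝ ∞ φ → HasCompactSupport φ → VectorCalculus.IsDivFree φ →
        Jst v * J1 v φ - kStar ^ 2 * M ^ 2 * (Wpa v * A1 v φ + Zen v * C1 v φ) = ∫ x, ⟪v x, φ x⟫_ℝ ∂μ := by
  classical
  set C : ℝ := kStar ^ 2 * Zen v * Wpa v with hCdef
  have hZ0 : 0 ≤ Zen v := integral_nonneg fun x => sq_nonneg _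
  have hW0 : 0 ≤ Wpa v := integral_nonneg fun x => frobeniusNormSq_nonneg _
  have hC0 : 0 ≤ C := by positivity
  -- the space of test fields (smooth, compactly supported, divergence free), a submodule of `ℝ³ → ℝ³`
  let T : Submodule ℝ (E3 → E3) :=
    { carrier := {φ | ContDiff ℝ ∞ φ ∧ HasCompactSupport φ ∧ VectorCalculus.IsDivFree φ}
      add_mem' := by
        rintro a b ⟨ha, hac, had⟩ ⟨hb, hbc, hbd⟩
        exact ⟨ha.add hb, hac.add hbc,
          isDivFree_add_pi (ha.differentiable (by simp)) (hb.differentiable (by simp)) had hbd⟩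
      zero_mem' := by
        refine ⟨contDiff_const, ?_, fun x => ?_⟩
        · exact HasCompactSupport.intro isCompact_singleton (K := {(0 : E3)}) fun x _ => rfl
        · unfold VectorCalculus.divergence
          rw [fderiv_zero]
          simp
      smul_mem' := by
        rintro c a ⟨ha, hac, had⟩
        refine ⟨ha.const_smul c, ?_, isDivFree_smul_pi (ha.differentiable (by simp)) had c⟩
        exact hac.mono (Function.support_const_smul_subset c a) }
  -- the pairing `φ ↦ ⟪v, φ⟫ ∈ C_c(ℝ³, ℝ)`
  let A : T →ₗ[ℝ] C_c(E3, ℝ) :=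
    { toFun := fun φ => ⟨⟨fun x => ⟪v x, (φ : E3 → E3) x⟫_ℝ, hv.continuous.inner φ.2.1.continuous⟩,
        hasCompactSupport_inner_of_right v φ.2.2.1⟩
      map_add' := fun φ ψ => by
        ext x
        simp [inner_add_right]
      map_smul' := fun c φ => by
        ext x
        simp [real_inner_smul_right] }
  have hA : ∀ (φ : T) (x : E3), A φ x = ⟪v x, (φ : E3 → E3) x⟫_ℝ := fun φ x => rfl
  -- the first-variation functional, a linear map on test fields
  let L : T →ₗ[ℝ] ℝ :=
    { toFun := fun φ => Jst v * J1 v φ - kStar ^ 2 * M ^ 2 * (Wpa v * A1 v φ + Zen v * C1 v φ)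
      map_add' := by
        rintro ⟨a, ha, hac, -⟩ ⟨b, hb, hbc, -⟩
        simp only [Submodule.coe_add]
        rw [J1_add hv ha hac hb hbc, A1_add hv ha hac hb hbc, C1_add hv ha hac hb hbc]
        ring
      map_smul' := by
        rintro c ⟨a, ha, -, -⟩
        simp only [Submodule.coe_smul, RingHom.id_apply, smul_eq_mul]
        rw [J1_smul ha, A1_smul ha, C1_smul ha]
        ring }
  have hL : ∀ φ : T, L φ = Jst v * J1 v φ - kStar ^ 2 * M ^ 2 * (Wpa v * A1 v φ + Zen v * C1 v φ) :=
    fun φ => rfl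
  -- the sublinear dominating functional `N g = C · sup g⁺`
  have hbdd : ∀ g : C_c(E3, ℝ), BddAbove (Set.range fun x => max (g x) 0) := fun g => by
    obtain ⟨K, hK⟩ := g.continuous.bounded_above_of_compact_support g.hasCompactSupport
    refine ⟨max K 0, ?_⟩
    rintro _ ⟨x, rfl⟩
    exact max_le_max ((le_abs_self _).trans ((Real.norm_eq_abs _).symm.le.trans (hK x))) le_rfl
  have hle_sup : ∀ (g : C_c(E3, ℝ)) (x : E3), g x ≤ ⨆ y, max (g y) 0 := fun g x =>
    (le_max_left _ _).trans (le_ciSup (hbdd g) x)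
  have hsup0 : ∀ g : C_c(E3, ℝ), 0 ≤ ⨆ y, max (g y) 0 := fun g =>
    (le_max_right _ _).trans (le_ciSup (hbdd g) 0)
  let N : C_c(E3, ℝ) → ℝ := fun g => C * ⨆ y, max (g y) 0
  have hN : ∀ g, N g = C * ⨆ y, max (g y) 0 := fun g => rfl
  have N_hom : ∀ c : ℝ, 0 < c → ∀ g, N (c • g) = c * N g := by
    intro c hc g
    rw [hN, hN]
    have hfun : (fun y => max ((c • g) y) 0) = fun y => c * max (g y) 0 := funext fun y => by
      rw [CompactlySupportedContinuousMap.smul_apply, smul_eq_mul, mul_max_of_nonneg _ _ hc.le, mul_zero]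
    rw [show (⨆ y, max ((c • g) y) 0) = ⨆ y, c * max (g y) 0 from congrArg iSup hfun,
      ← Real.mul_iSup_of_nonneg hc.le]
    ring
  have N_add : ∀ g₁ g₂, N (g₁ + g₂) ≤ N g₁ + N g₂ := by
    intro g₁ g₂
    rw [hN, hN, hN, ← mul_add]
    refine mul_le_mul_of_nonneg_left (ciSup_le fun x => ?_) hC0
    rw [CompactlySupportedContinuousMap.add_apply]
    exact max_le (add_le_add (hle_sup g₁ x) (hle_sup g₂ x)) (add_nonneg (hsup0 g₁) (hsup0 g₂))
  have N_zero : N 0 = 0 := by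
    rw [hN]
    have hfun : (fun y => max ((0 : C_c(E3, ℝ)) y) 0) = fun _ => (0 : ℝ) := funext fun y => by simp
    rw [show (⨆ y, max ((0 : C_c(E3, ℝ)) y) 0) = ⨆ _ : E3, (0 : ℝ) from congrArg iSup hfun, ciSup_const, mul_zero]
  -- KKT: `L ≤ N ∘ A`, hence `ker A ≤ ker L`
  have hKKT : ∀ φ : T, L φ ≤ N (A φ) := fun φ => by
    obtain ⟨hφ, hφc, hφdiv⟩ := φ.2
    rw [hL, hN]
    have h := firstVar_le_of_inner_le hv hdiv hMpos hM hB h1 h2 hatt hφ hφc hφdiv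
      (s := ⨆ y, max ((A φ) y) 0) fun x => hle_sup (A φ) x
    linarith
  have hker : LinearMap.ker A ≤ LinearMap.ker L := by
    intro φ hφ
    rw [LinearMap.mem_ker] at hφ ⊢
    have hp := hKKT φ
    have hm := hKKT (-φ)
    rw [hφ, N_zero] at hp
    rw [map_neg, map_neg, hφ, neg_zero, N_zero] at hm
    linarith
  -- `L` factors through the range of `A`
  let f : LinearMap.range A →ₗ[ℝ] ℝ :=
    ((LinearMap.ker A).liftQ L hker).comp A.quotKerEquivRange.symm.toLinearMap
  have hf : ∀ φ : T, f ⟨A φ, LinearMap.mem_range_self A φ⟩ = L φ := fun φ => by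
    show ((LinearMap.ker A).liftQ L hker) (A.quotKerEquivRange.symm ⟨A φ, LinearMap.mem_range_self A φ⟩) = L φ
    rw [LinearMap.quotKerEquivRange_symm_apply_image A φ (LinearMap.mem_range_self A φ), Submodule.mkQ_apply,
      Submodule.liftQ_apply]
  let fP : C_c(E3, ℝ) →ₗ.[ℝ] ℝ := ⟨LinearMap.range A, f⟩
  -- Hahn–Banach
  obtain ⟨Λ, hΛf, hΛN⟩ := exists_extension_of_le_sublinear fP N N_hom N_add fun g => by
    obtain ⟨φ, hφ⟩ := (LinearMap.mem_range).1 g.2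
    have hg : g = ⟨A φ, LinearMap.mem_range_self A φ⟩ := Subtype.ext hφ.symm
    calc fP g = f g := rfl
      _ = L φ := by rw [hg]; exact hf φ
      _ ≤ N (A φ) := hKKT φ
      _ = N g := by rw [hg]
  -- positivity of the extension
  have hΛpos : ∀ g : C_c(E3, ℝ), 0 ≤ g → 0 ≤ Λ g := fun g hg => by
    have h := hΛN (-g)
    have hNg : N (-g) = 0 := by
      rw [hN]
      have hfun : (fun y => max ((-g) y) 0) = fun _ => (0 : ℝ) := funext fun y => by
        rw [CompactlySupportedContinuousMap.neg_apply, max_eq_right]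
        have := (CompactlySupportedContinuousMap.le_def.1 hg) y
        simp only [CompactlySupportedContinuousMap.coe_zero, Pi.zero_apply] at this
        linarith
      rw [show (⨆ y, max ((-g) y) 0) = ⨆ _ : E3, (0 : ℝ) from congrArg iSup hfun, ciSup_const, mul_zero]
    rw [map_neg, hNg] at h
    linarith
  let Λp : C_c(E3, ℝ) →ₚ[ℝ] ℝ := PositiveLinearMap.mk₀ Λ hΛpos
  have hΛp : ∀ g, Λp g = Λ g := fun g => rfl
  -- Riesz–Markov–Kakutani; mass bound via closed balls
  have hmass : RealRMK.rieszMeasure Λp univ ≤ ENNReal.ofReal C := by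
    have hball : ∀ r : ℝ, 0 < r → RealRMK.rieszMeasure Λp (closedBall 0 r) ≤ ENNReal.ofReal C := fun r hr => by
      let b : ContDiffBump (0 : E3) := ⟨r, r + 1, hr, by linarith⟩
      let g : C_c(E3, ℝ) := ⟨⟨b, b.continuous⟩, b.hasCompactSupport⟩
      have hg : ∀ x, g x = b x := fun x => rfl
      have hg0 : ∀ x, 0 ≤ g x := fun x => by rw [hg]; exact b.nonneg
      have hg1 : ∀ x ∈ closedBall (0 : E3) r, g x = 1 := fun x hx => by rw [hg]; exact b.one_of_mem_closedBall hx
      calc RealRMK.rieszMeasure Λp (closedBall 0 r) ≤ ENNReal.ofReal (Λp g) :=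
            RealRMK.rieszMeasure_le_of_eq_one Λp hg0 (isCompact_closedBall 0 r) hg1
        _ ≤ ENNReal.ofReal C := by
            refine ENNReal.ofReal_le_ofReal ((hΛN g).trans ?_)
            rw [hN]
            have : (⨆ y, max (g y) 0) ≤ 1 := ciSup_le fun y => max_le (by rw [hg]; exact b.le_one) zero_le_one
            nlinarith
    have hmono : Monotone fun n : ℕ => closedBall (0 : E3) ((n : ℝ) + 1) := fun m n hmn =>
      closedBall_subset_closedBall (by exact_mod_cast Nat.add_le_add_right hmn 1)
    have hunion : (⋃ n : ℕ, closedBall (0 : E3) ((n : ℝ) + 1)) = univ := by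
      refine eq_univ_of_forall fun x => ?_
      obtain ⟨n, hn⟩ := exists_nat_ge ‖x‖
      exact mem_iUnion.2 ⟨n, by rw [mem_closedBall, dist_zero_right]; linarith⟩
    have ht := tendsto_measure_iUnion_atTop (μ := RealRMK.rieszMeasure Λp) hmono
    rw [hunion] at ht
    exact le_of_tendsto' ht fun n => hball _ (by positivity)
  refine ⟨RealRMK.rieszMeasure Λp, ⟨lt_of_le_of_lt hmass ENNReal.ofReal_lt_top⟩, hmass, ?_⟩
  intro φ hφ hφc hφdiv
  have hφT : φ ∈ T := ⟨hφ, hφc, hφdiv⟩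
  have hrep := RealRMK.integral_rieszMeasure Λp (A ⟨φ, hφT⟩)
  have hΛA : Λp (A ⟨φ, hφT⟩) = L ⟨φ, hφT⟩ := by
    rw [hΛp, hΛf ⟨A ⟨φ, hφT⟩, LinearMap.mem_range_self A _⟩]
    exact hf ⟨φ, hφT⟩
  rw [hΛA, hL] at hrep
  rw [← hrep]
  rfl
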